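import Literature.NumberTheory.EllipticCurves.ZpExtensionScalarTwistResidualQuotient
import Literature.NumberTheory.EllipticCurves.PointDivisibilityProofs
import Literature.NumberTheory.EllipticCurves.KummerMap
import HarnessLib

/-!
# `T̄_𝔮 = E[p]`: the residual presentation of Howard's specialised module `T_𝔮/p^k T_𝔮 = E[p^k] ⊗ A_{m,k}(ψ)`
# by `E[p]`, unconditionally for an elliptic curve (proofs file)

Topic `NumberTheory/EllipticCurves`; the E-instance of `ZpExtensionScalarTwistResidualQuotient`
(`exists_isQuotientBy_maximalIdeal_eisensteinTwist`: for an `A_{m,k}`-module `N` through the residue character and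
a reduction datum `r : M ↠ N` with kernel `pM`, an `A_{m,k}`-linear equivariant `π : A_{m,k} ⊗ M ↠ N` presenting the
quotient by `𝔪_{A_{m,k}}`). THEOREMS ONLY; no definition, no named fact, no instance, no `sorry`.

Here `M = E[p^k]` (`WeierstrassCurve.torsionGaloisModule ((p:ℤ)^k)`), `N = E[p]` with the `A_{m,k}`-module structure
`EisensteinCoeff.residueModule` (`[F] • P = F(0)·P`), and `r = p^{k−1}· : E[p^k] ↠ E[p]` — surjective by the
divisibility of `E(K̄)` (`zsmul_geomPoints_surjective_holds`, Silverman VIII.§2), kernel `p·E[p^k]`, equivariant: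

* `WeierstrassCurve.prime_nsmul_geomTorsion_eq_zero` — `p • Q = 0` on `E[p]`;
* `WeierstrassCurve.exists_geomTorsion_primePow_reduction` — the reduction datum `r`;
* **`WeierstrassCurve.exists_isQuotientBy_eisensteinTwist_geomTorsion`** — there is an `A_{m,k}`-linear
  `π : E[p^k] ⊗ A_{m,k} → E[p]` with `π(1 ⊗ P) = p^{k−1} P` and
  `Howard2004.IsQuotientBy (κ.eisensteinTwist (E[p^k]) hm k) 𝔪_{A_{m,k}} (E[p]) π` — Howard, proof of Prop. 2.1.3:
  «`T̄_𝔭 ≅ E[p] ⊗ S_𝔭/𝔪` … the action of `G_K` on `S_𝔭/𝔪` … is trivial on the second factor» — i.e. the residual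
  presentation `(T̄, π̄)` that the first clause of `Howard2004.H1` and `H2`/`H5a`/`H5b` quantify over, for the
  specialised triple at every level `k ≥ 1` (`m ≥ 1`), for EVERY anticyclotomic datum `κ` (the twist is residually
  trivial) — so H.1/H.2/H.5 for `T_𝔮` reduce to the same statements for `E[p]` (tree: p630891, p635540).

Cell `pub/bsd-print-x9`, seat `bsd-line-x9-p1-w2` (g5), v9-plan STUB 1a of the shared μ-item on crux
stmt-BirchSwinnertonDyer-27077.

References: [Howard2004HeegnerKolyvagin] proof of Prop. 2.1.3 (arXiv 3.1.3), §1.3 H.1/H.2/H.5; [SilvermanAEC2009] VIII.§2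
(`0 → E[m] → E(K̄) → E(K̄) → 0`).
-/

noncomputable section

open scoped TensorProduct

namespace WeierstrassCurve

open Literature.NumberTheory.EllipticCurves Literature.NumberTheory.GaloisRepresentations Field

variable {K : Type} [Field K] (W : WeierstrassCurve K) {p : ℕ} [hp : Fact p.Prime]

omit hp in
/-- `p • Q = 0` for `Q ∈ E[p]` (as an element of the subgroup). [cite: SilvermanAEC2009, III.§6 (E[m])] -/
theorem prime_nsmul_geomTorsion_eq_zero (Q : geomTorsion W (p : ℤ)) : p • Q = 0 := by
  apply Subtype.ext
  have h := (mem_geomTorsion_iff W (p : ℤ) (Q : geomPoints W)).mp Q.2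
  rw [AddSubmonoidClass.coe_nsmul, ← natCast_zsmul, h]
  rfl

/-- **The reduction datum `r = p^{k−1}· : E[p^k] ↠ E[p]`** (`k ≥ 1`, `W` elliptic): an additive surjection
(divisibility of `E(K̄)`), with kernel `p·E[p^k]` (again by divisibility) and `Γ_K`-equivariant.
[cite: SilvermanAEC2009, VIII.§2 (0 → E[m] → E(K̄) → E(K̄) → 0)] [cite: Howard2004HeegnerKolyvagin, proof of Prop. 2.1.3] -/
theorem exists_geomTorsion_primePow_reduction [W.IsElliptic] {k : ℕ} (hk : 1 ≤ k) :
    ∃ r : geomTorsion W ((p : ℤ) ^ k) →+ geomTorsion W (p : ℤ),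
      (∀ P : geomTorsion W ((p : ℤ) ^ k), ((r P : geomTorsion W (p : ℤ)) : geomPoints W) =
        ((p : ℤ) ^ (k - 1)) • (P : geomPoints W)) ∧
      Function.Surjective r ∧
      (∀ P : geomTorsion W ((p : ℤ) ^ k), r P = 0 ↔ ∃ Q : geomTorsion W ((p : ℤ) ^ k), P = p • Q) ∧
      ∀ (σ : absoluteGaloisGroup K) (P : geomTorsion W ((p : ℤ) ^ k)),
        r (W.torsionGaloisModule ((p : ℤ) ^ k) σ P) = W.torsionGaloisModule (p : ℤ) σ (r P) := by
  have hpk : ((p : ℤ) ^ (k - 1)) * (p : ℤ) = (p : ℤ) ^ k := by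
    rw [← pow_succ, Nat.sub_add_cancel hk]
  have hdiv : ∀ {n : ℤ}, n ≠ 0 → Function.Surjective fun Q : geomPoints W ↦ n • Q :=
    fun {n} hn ↦ W.zsmul_geomPoints_surjective_holds hn
  let r : geomTorsion W ((p : ℤ) ^ k) →+ geomTorsion W (p : ℤ) :=
    ((zsmulAddGroupHom (α := geomPoints W) ((p : ℤ) ^ (k - 1))).comp
      (geomTorsion W ((p : ℤ) ^ k)).subtype).codRestrict (geomTorsion W (p : ℤ)) fun P ↦ by
        rw [mem_geomTorsion_iff, AddMonoidHom.coe_comp, Function.comp_apply, AddSubgroup.coe_subtype,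
          zsmulAddGroupHom_apply, smul_smul, mul_comm, hpk, ← mem_geomTorsion_iff]
        exact P.2
  have hr : ∀ P : geomTorsion W ((p : ℤ) ^ k), ((r P : geomTorsion W (p : ℤ)) : geomPoints W) =
      ((p : ℤ) ^ (k - 1)) • (P : geomPoints W) := fun _ ↦ rfl
  refine ⟨r, hr, ?_, ?_, ?_⟩
  · -- surjective: divide `Q ∈ E[p]` by `p^{k-1}`
    intro Q
    obtain ⟨P₀, hP₀⟩ := hdiv (n := (p : ℤ) ^ (k - 1)) (pow_ne_zero _ (by exact_mod_cast hp.out.ne_zero))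
      (Q : geomPoints W)
    dsimp only at hP₀
    have hP₀mem : P₀ ∈ geomTorsion W ((p : ℤ) ^ k) := by
      rw [mem_geomTorsion_iff, ← hpk, mul_comm, mul_smul]
      change (p : ℤ) • ((p : ℤ) ^ (k - 1) • P₀) = 0
      rw [hP₀, ← mem_geomTorsion_iff]
      exact Q.2
    exact ⟨⟨P₀, hP₀mem⟩, Subtype.ext hP₀⟩
  · -- kernel `= p·E[p^k]`
    intro P
    constructor
    · intro hP
      have hP' : ((p : ℤ) ^ (k - 1)) • (P : geomPoints W) = 0 := by
        rw [← hr, hP]; rfl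
      obtain ⟨P₁, hP₁⟩ := hdiv (n := (p : ℤ)) (by exact_mod_cast hp.out.ne_zero) (P : geomPoints W)
      dsimp only at hP₁
      have hP₁mem : P₁ ∈ geomTorsion W ((p : ℤ) ^ k) := by
        rw [mem_geomTorsion_iff, ← hpk, mul_smul]
        change ((p : ℤ) ^ (k - 1)) • ((p : ℤ) • P₁) = 0
        rw [hP₁, hP']
      refine ⟨⟨P₁, hP₁mem⟩, Subtype.ext ?_⟩
      rw [AddSubmonoidClass.coe_nsmul, ← natCast_zsmul]
      exact hP₁.symm
    · rintro ⟨Q, rfl⟩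
      apply Subtype.ext
      rw [hr, AddSubmonoidClass.coe_nsmul, ← natCast_zsmul, smul_smul, hpk, ZeroMemClass.coe_zero,
        ← mem_geomTorsion_iff]
      exact Q.2
  · -- equivariance
    intro σ P
    apply Subtype.ext
    rw [hr, torsionGaloisModule_apply_apply, torsionGaloisModule_apply_apply,
      Literature.NumberTheory.EllipticCurves.AddSubgroup.torsionBy.coe_smul,
      Literature.NumberTheory.EllipticCurves.AddSubgroup.torsionBy.coe_smul, hr, smul_zsmul_geomPoints]

/-- **`T̄_𝔮 = E[p]` as an object of `Quot(T_𝔮/p^k)`.** For an elliptic curve `W/K`, a prime `p`, `m, k ≥ 1` and ANY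
`ℤ_p`-extension datum `κ`: with `E[p]` carrying the `A_{m,k}`-module structure through the residue character
(`EisensteinCoeff.residueModule`), there is an `A_{m,k}`-LINEAR `π : E[p^k] ⊗ A_{m,k} → E[p]` with `π (1 ⊗ P) = p^{k−1} P`
such that `Howard2004.IsQuotientBy (κ.eisensteinTwist (E[p^k]) hm k) 𝔪_{A_{m,k}} (E[p]) π`: surjective, kernel
`𝔪·(E[p^k] ⊗ A_{m,k})`, and `Γ_K`-equivariant from the ψ-TWISTED module to the untwisted `E[p]`.
[cite: Howard2004HeegnerKolyvagin, proof of Prop. 2.1.3 (T̄_𝔭 ≅ E[p] ⊗ S_𝔭/𝔪) and §1.3 H.1] -/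
theorem exists_isQuotientBy_eisensteinTwist_geomTorsion [W.IsElliptic] (κ : ZpExtension K p) {m : ℕ}
    (hm : 1 ≤ m) {k : ℕ} (hk : 1 ≤ k) :
    letI := IwasawaAlgebra.EisensteinCoeff.residueModule (p := p) (m := m) (k := k) hm hk
      (W.prime_nsmul_geomTorsion_eq_zero (p := p))
    ∃ π : IwasawaAlgebra.EisensteinCoeff.Twisted p m k (geomTorsion W ((p : ℤ) ^ k)) →ₗ[
        IwasawaAlgebra.EisensteinCoeff p m k] geomTorsion W (p : ℤ),
      (∀ P : geomTorsion W ((p : ℤ) ^ k),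
        ((π (IwasawaAlgebra.EisensteinCoeff.Twisted.tmul 1 P) : geomTorsion W (p : ℤ)) : geomPoints W) =
          ((p : ℤ) ^ (k - 1)) • (P : geomPoints W)) ∧
      Literature.NumberTheory.GaloisCohomology.Howard2004.IsQuotientBy (κ.eisensteinTwist (W.torsionGaloisModule ((p : ℤ) ^ k)) hm k)
        (@IsLocalRing.maximalIdeal _ _ (IwasawaAlgebra.EisensteinCoeff.isLocalRing_eisensteinCoeff p hm hk))
        (W.torsionGaloisModule (p : ℤ)) π := by
  letI := IwasawaAlgebra.EisensteinCoeff.residueModule (p := p) (m := m) (k := k) hm hk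
    (W.prime_nsmul_geomTorsion_eq_zero (p := p))
  obtain ⟨r, hr, hrsurj, hrker, hrρ⟩ := W.exists_geomTorsion_primePow_reduction (p := p) hk
  obtain ⟨π, hπ, hq⟩ := κ.exists_isQuotientBy_maximalIdeal_eisensteinTwist
    (W.torsionGaloisModule ((p : ℤ) ^ k)) hm hk
    (fun c n ↦ IwasawaAlgebra.EisensteinCoeff.residueModule_smul p hm hk _ c n)
    (W.torsionGaloisModule (p : ℤ)) r hrsurj hrker hrρ
  exact ⟨π, fun P ↦ by rw [hπ, hr], hq⟩

end WeierstrassCurve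

end
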